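import Literature.NumberTheory.PAdicHodge.DualExpEllipticLogTraceNondegenerate
import Literature.NumberTheory.EllipticCurves.PadicLogFiniteExtensionLocalFieldProofs
import Literature.NumberTheory.PAdicHodge.PadicFieldSpectralNorm
import Literature.IUT.LogVolume.LocalFieldTraceRetraction
import HarnessLib

/-!
# A nonzero additive `ℤ_p`-valued functional on `E(F₀)` for a `p`-adic field `F₀` unramified at the chart scale

Topic `Literature/NumberTheory/PAdicHodge`; THEOREMS ONLY (no definition, no named fact, no instance, no `sorry`). The input
`hφ : ∃ φ : E(F₀) →+ ℤ_p, φ ≠ 0` of the Galois-descent / from-above steps of Kato's explicit reciprocity law in the tree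
(`ReciprocityLawTowerAssembly`, `…ReciprocityGaloisDescent.exists_const_tower_clauses_of_galois`,
`…ReciprocityTowerFromAbove.exists_const_tower_clauses_of_formula_above`: it is what makes the descended constant `c₀` nonzero), discharged
at the fields the line `kato_lever` of crux K★ `stmt-BirchSwinnertonDyer-22226` needs it: `F₀ = ℚ_v` (more generally any `F₀` and compatible
`w₀` with `w₀ x < 1 → w₀ x ≤ w₀ p`, i.e. the kernel of reduction IS the level `E⁽ᵖ⁾`).

* §1 `index_kernel_ne_zero` — over a non-archimedean local field the kernel of reduction `E₁(F₀)` has finite index in `E(F₀)` (the DVR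
  statement `WeierstrassCurve.index_ne_zero_of_forall_some_mem` — Silverman's compactness argument made algebraic — read on an `𝒪[F₀]`-model).
* §2 `norm_trace_le_one_of_valuation_le_one` — `‖Tr_{F₀/ℚ_p}(y)‖ ≤ 1` for `valuation F₀ y ≤ 1`, for ANY `ℚ_p`-algebra structure on `F₀`
  (rigidity `LocalField.ringHom_padic_ext`; the bound is IUT's `norm_trace_le` for the `ℚ_p`-normalised absolute value `PadicField.normedField`).
* §4 `exists_pow_forall_nsmul_mem_level` (ONE `r` with `p^r • E₁(F) ⊆ E⁽ᵖ⁾`, discreteness) and ★★ `exists_addMonoidHom_point_padicInt_ne_zero'` /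
  `…_baseChange_…'` — the same WITHOUT the unramifiedness clause (any `p`-adic field).
* §3 ★ `exists_addMonoidHom_point_padicInt_ne_zero` — **`∃ φ : E(F₀) →+ ℤ_p, φ ≠ 0`**: `φ(P) := Tr_{F₀/ℚ_p}(log_ω(M • P))` with
  `M = [E(F₀) : E₁(F₀)]` (`M • P ∈ E₁ = E⁽ᵖ⁾`, so `|log_ω(M • P)| ≤ |p|`, Silverman IV.6.4 (b)); additive by [ADD]; nonzero by the non-degeneracy
  [N] `eq_zero_of_forall_trace_mul_padicLog_eq_zero` (`Tr(M · log_ω P) = 0 ∀ P ⟹ M = 0`); and its `W ×_{K₀} F₀` reading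
  `exists_addMonoidHom_baseChange_point_padicInt_ne_zero` (the literal `hφ`).

## References
* J. H. Silverman, *AEC* (2009), Thm. IV.6.4, Prop. VII.2.2, VII.6 Cor. 6.2 / Exercise 7.6. [SilvermanAEC2009]
* K. Kato, LNM 1553 (1993), Ch. II §1.2.4, Thm. 1.4.1 (4). [Kato1993LNM1553]
* J. Neukirch, *Algebraic Number Theory* (1999), Ch. II (4.8), (5.2). [NeukirchANT1999]
-/

noncomputable section

open scoped Classical NNReal
open Field ValuativeRel
open Literature.NumberTheory.GaloisRepresentations
open Literature.NumberTheory.GaloisRepresentations.IsNonarchimedeanLocalField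
open Literature.NumberTheory.EllipticCurves Literature.NumberTheory.EllipticCurves.FormalGroupChart WeierstrassCurve

namespace Literature.NumberTheory.PAdicHodge

variable {F : Type} [Field F] [ValuativeRel F] [TopologicalSpace F] [IsNonarchimedeanLocalField F] [CharZero F]
  {p : ℕ} [Fact p.Prime]

/-! ### §1 `E₁(F)` has finite index -/

omit [CharZero F] in
/-- **The kernel of reduction has finite index in `E(F)`** over a non-archimedean local field: for an elliptic Weierstrass equation `V`
integral for a compatible valuation `w`, `[E(F) : E₁(F)] ≠ 0` (as an index: `(kernel w V).index ≠ 0`). Read on an `𝒪[F]`-model of `V`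
from `WeierstrassCurve.index_ne_zero_of_forall_some_mem` (every subgroup containing the points with non-integral `x` has finite index).
[cite: SilvermanAEC2009, VII.6 Cor. 6.2 and Exercise 7.6; Prop. VII.2.2] -/
theorem index_kernel_ne_zero (V : WeierstrassCurve F) [V.IsElliptic] (w : Valuation F ℝ≥0) [w.Compatible]
    [hV : V.IsIntegral w.integer] : (kernel w V).index ≠ 0 := by
  have hwv : w.IsEquiv (valuation F) := ValuativeRel.isEquiv w (valuation F)
  have hint : ∀ {x : F}, w x ≤ 1 → x ∈ 𝒪[F] := fun hx =>
    (Valuation.mem_integer_iff _ _).mpr (hwv.le_one_iff_le_one.mp hx)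
  obtain ⟨W₀, hW₀⟩ : ∃ W₀ : WeierstrassCurve 𝒪[F], W₀.baseChange F = V :=
    ⟨⟨⟨V.a₁, hint (val_a₁_le_one (w := w) (V := V))⟩, ⟨V.a₂, hint (val_a₂_le_one (w := w) (V := V))⟩,
      ⟨V.a₃, hint (val_a₃_le_one (w := w) (V := V))⟩, ⟨V.a₄, hint (val_a₄_le_one (w := w) (V := V))⟩,
      ⟨V.a₆, hint (val_a₆_le_one (w := w) (V := V))⟩⟩, rfl⟩
  subst hW₀
  have hΔ : W₀.Δ ≠ 0 := by
    intro h0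
    apply (W₀.baseChange F).Δ'.ne_zero
    rw [coe_Δ', baseChange, map_Δ, h0, map_zero]
  refine WeierstrassCurve.index_ne_zero_of_forall_some_mem (R := 𝒪[F]) W₀ hΔ (kernel w (W₀.baseChange F)) ?_
  intro x y h hx
  have hx1 : 1 < w x := by
    rw [← not_le]
    exact fun hle => hx ⟨⟨x, hint hle⟩, rfl⟩
  rw [some_mem_kernel_iff]
  exact hx1

/-! ### §2 The trace of an integer is a `p`-adic integer -/

/-- `‖Tr_{F/ℚ_p}(y)‖ ≤ 1` for `valuation F y ≤ 1`, canonical `ℚ_p`-structure: the trace does not increase the `ℚ_p`-normalised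
absolute value (IUT `norm_trace_le`), whose closed unit ball is `𝒪[F]`. [cite: NeukirchANT1999, Ch. II (4.8) and (5.2)] -/
private theorem norm_trace_le_one_padicAlgebra (hp : valuation F p < 1) {y : F} (hy : valuation F y ≤ 1) :
    letI := LocalField.padicAlgebra F p hp; ‖Algebra.trace ℚ_[p] F y‖ ≤ 1 := by
  letI := LocalField.padicAlgebra F p hp
  letI := PadicField.normedField F p hp
  letI := PadicField.normedAlgebra F p hp
  haveI := PadicField.isUltrametricDist F p hp
  haveI := PadicField.properSpace F p hp
  have h := Literature.IUT.LogVolume.norm_trace_le (k := ℚ_[p]) (k' := F) (Algebra.ofId ℚ_[p] F) y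
  exact h.trans ((PadicField.norm_le_one_iff_valuation_le_one F p hp y).2 hy)

/-- **`‖Tr_{F/ℚ_p}(y)‖ ≤ 1` for `valuation F y ≤ 1`**, for ANY `ℚ_p`-algebra structure on the `p`-adic field `F` (all ring maps
`ℚ_p → F` coincide, `LocalField.ringHom_padic_ext`): for the canonical structure the trace does not increase the `ℚ_p`-normalised absolute
value (IUT `norm_trace_le`), whose closed unit ball is `𝒪[F]` (`PadicField.norm_le_one_iff_valuation_le_one`). [cite: NeukirchANT1999, Ch. II (4.8) and (5.2)] -/
theorem norm_trace_le_one_of_valuation_le_one (hp : valuation F p < 1) [Algebra ℚ_[p] F] {y : F}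
    (hy : valuation F y ≤ 1) : ‖Algebra.trace ℚ_[p] F y‖ ≤ 1 := by
  -- the `ℚ_p`-algebra structure is the canonical one
  have halg : (inferInstance : Algebra ℚ_[p] F) = LocalField.padicAlgebra F p hp := by
    refine Algebra.algebra_ext _ _ fun c => ?_
    exact RingHom.congr_fun (LocalField.ringHom_padic_ext (algebraMap ℚ_[p] F)
      (@algebraMap ℚ_[p] F _ _ (LocalField.padicAlgebra F p hp))) c
  have e := norm_trace_le_one_padicAlgebra (F := F) hp hy
  rw [← halg] at e
  exact e

/-! ### §3 A nonzero additive `ℤ_p`-valued functional on `E(F)` -/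

/-- ★ **A nonzero additive functional `φ : E(F) →+ ℤ_p`** on the points of an elliptic curve over a `p`-adic field `F`, integral for a
compatible valuation `w` UNRAMIFIED at the chart scale (`w x < 1 → w x ≤ w p`, e.g. `F = ℚ_p`, `ℚ_v`; then the kernel of reduction is the
level `E⁽ᵖ⁾`): `φ(P) := Tr_{F/ℚ_p}(log_ω(M • P))` with `M = [E(F) : E₁(F)]` — well defined in `ℤ_p` since `M • P ∈ E₁ = E⁽ᵖ⁾` gives
`|log_ω(M • P)| ≤ |p|` (Silverman IV.6.4 (b)); additive by [ADD]; nonzero because `Tr(M · log_ω P) = 0` for all `P` would force `M = 0` in `F`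
by the non-degeneracy [N] `eq_zero_of_forall_trace_mul_padicLog_eq_zero`. The input `hφ` of the descent of Kato's reciprocity law.
[cite: SilvermanAEC2009, Thm. IV.6.4 (b) with Prop. VII.2.2] [cite: Kato1993LNM1553, Ch. II §1.2.4 and Thm. 1.4.1 (4)] -/
theorem exists_addMonoidHom_point_padicInt_ne_zero (hp : valuation F p < 1) [Algebra ℚ_[p] F] (V : WeierstrassCurve F)
    [V.IsElliptic] (w : Valuation F ℝ≥0) [w.Compatible] [hV : V.IsIntegral w.integer]
    (hur : ∀ x : F, w x < 1 → w x ≤ w p) :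
    ∃ φ : V.toAffine.Point →+ ℤ_[p], φ ≠ 0 := by
  have hp0 : (p : F) ≠ 0 := Nat.cast_ne_zero.mpr (Fact.out : p.Prime).ne_zero
  have hwv : w.IsEquiv (valuation F) := ValuativeRel.isEquiv w (valuation F)
  have hwp : w (p : F) < 1 := hwv.lt_one_iff_lt_one.mpr hp
  -- `M = [E(F) : E₁(F)]`, and `M • P ∈ E₁ = E⁽ᵖ⁾`
  set M : ℕ := (kernel w V).index with hM
  have hM0 : M ≠ 0 := index_kernel_ne_zero V w
  have hlev : ∀ P : V.toAffine.Point, M • P ∈ level w V (w (p : F)) := fun P => by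
    have hk : M • P ∈ kernel w V := AddSubgroup.nsmul_index_mem (kernel w V) P
    exact ⟨hk, hur _ (val_zCoord_lt_one hk)⟩
  -- `|log_ω(M • P)| ≤ |p| ≤ 1`, so its trace is a `p`-adic integer
  have hval : ∀ P : V.toAffine.Point, valuation F (padicLogPointFiniteExt w V p (M • P)) ≤ 1 := fun P => by
    have h := val_padicLogPointFiniteExt_le_of_mem_level hp0 hwp (limitLog_spec_of_isNonarchimedeanLocalField V w hp0 hp)
      (hlev P)
    exact hwv.le_one_iff_le_one.mp (h.trans hwp.le)
  have hint : ∀ P : V.toAffine.Point, ‖Algebra.trace ℚ_[p] F (padicLogPointFiniteExt w V p (M • P))‖ ≤ 1 := fun P =>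
    norm_trace_le_one_of_valuation_le_one hp (hval P)
  -- the functional
  let φ : V.toAffine.Point →+ ℤ_[p] :=
    { toFun := fun P => ⟨Algebra.trace ℚ_[p] F (padicLogPointFiniteExt w V p (M • P)), hint P⟩
      map_zero' := by
        apply Subtype.ext
        change Algebra.trace ℚ_[p] F (padicLogPointFiniteExt w V p (M • (0 : V.toAffine.Point))) = 0
        rw [nsmul_zero, padicLogPointFiniteExt_zero_of_isNonarchimedeanLocalField V w hp0 hp, map_zero]
      map_add' := fun P Q => by
        apply Subtype.ext
        change Algebra.trace ℚ_[p] F (padicLogPointFiniteExt w V p (M • (P + Q))) =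
          Algebra.trace ℚ_[p] F (padicLogPointFiniteExt w V p (M • P)) +
            Algebra.trace ℚ_[p] F (padicLogPointFiniteExt w V p (M • Q))
        rw [nsmul_add, padicLogPointFiniteExt_add_of_isNonarchimedeanLocalField V w hp0 hp, map_add] }
  refine ⟨φ, fun h0 => hM0 ?_⟩
  -- if `φ = 0` then `Tr(M · log_ω P) = 0` for all `P`, so `M = 0` in `F` by [N]
  have hb : ∀ P : V.toAffine.Point, Algebra.trace ℚ_[p] F ((M : F) * padicLogPointFiniteExt w V p P) = 0 := fun P => by
    rw [← padicLogPointFiniteExt_nsmul_of_isNonarchimedeanLocalField V w hp0 hp P M]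
    have h := DFunLike.congr_fun h0 P
    exact congrArg ((↑) : ℤ_[p] → ℚ_[p]) h
  have hMF : (M : F) = 0 := eq_zero_of_forall_trace_mul_padicLog_eq_zero hp V w hb
  exact_mod_cast hMF

/-- ★ **`hφ` in the shape of the descent theorems**: for an elliptic curve `W/K₀`, a `p`-adic field `F₀ ⊇ K₀` and a compatible valuation
`w₀` making `W ×_{K₀} F₀` integral and unramified at the chart scale, `∃ φ : (W ×_{K₀} F₀)(F₀) →+ ℤ_p, φ ≠ 0` — the hypothesis `hφ` of
`ReciprocityLawTowerAssembly` / `exists_const_tower_clauses_of_galois` / `exists_const_tower_clauses_of_formula_above`, verbatim.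
[cite: SilvermanAEC2009, Thm. IV.6.4 (b) with Prop. VII.2.2] [cite: Kato1993LNM1553, Ch. II §1.2.4 and Thm. 1.4.1 (4)] -/
theorem exists_addMonoidHom_baseChange_point_padicInt_ne_zero {K₀ : Type} [Field K₀] (W : WeierstrassCurve K₀) [W.IsElliptic]
    [Algebra K₀ F] (hp : valuation F p < 1) (w : Valuation F ℝ≥0) [w.Compatible] [(W.baseChange F).IsIntegral w.integer]
    (hur : ∀ x : F, w x < 1 → w x ≤ w p) :
    ∃ φ : (W.baseChange F).toAffine.Point →+ ℤ_[p], φ ≠ 0 := by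
  letI : Algebra ℚ_[p] F := LocalField.padicAlgebra F p hp
  exact exists_addMonoidHom_point_padicInt_ne_zero hp (W.baseChange F) w hur


/-! ### §4 The same WITHOUT the unramifiedness clause: a UNIFORM `p`-power carries `E₁(F)` into the level -/

omit [CharZero F] [Fact p.Prime] in
/-- **Uniform version of `exists_pow_smul_mem_level_of_mem_kernel` over a non-archimedean local field**: ONE exponent `r` with
`p^r • P ∈ E⁽ᵖ⁾` for EVERY `P ∈ E₁(F)`. The valuation is discrete (`ValuativeRel.IsDiscrete`), so `|z(P)| < 1` forces `|z(P)| ≤ |ϖ|`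
for a uniformizer `ϖ`; then `|z(p • Q) − p·z(Q)| ≤ |z(Q)|²` gives, along `Q, p•Q, p²•Q, …`, either the level or `|z| ≤ |ϖ|^{2ʳ}`, which drops
below `|p|` at an `r` independent of `P`. [cite: SilvermanAEC2009, Prop. IV.3.2 and Prop. IV.2.3 with Prop. VII.2.2] -/
theorem exists_pow_forall_nsmul_mem_level (V : WeierstrassCurve F) [V.IsElliptic] (w : Valuation F ℝ≥0) [w.Compatible]
    [hV : V.IsIntegral w.integer] (hp0 : (p : F) ≠ 0) :
    ∃ r : ℕ, ∀ P ∈ kernel w V, (p ^ r) • P ∈ level w V (w (p : F)) := by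
  have hwv : w.IsEquiv (valuation F) := ValuativeRel.isEquiv w (valuation F)
  have hp : 0 < w (p : F) := (Valuation.pos_iff w).mpr hp0
  -- a uniformizer `ϖ` and the uniform bound `|z(P)| ≤ |ϖ| < 1` on `E₁`
  obtain ⟨ϖ, hϖ⟩ := ValuativeRel.valuation_surjective (K := F) (ValuativeRel.uniformizer F)
  have hρ1 : w ϖ < 1 := hwv.lt_one_iff_lt_one.mpr (by rw [hϖ]; exact ValuativeRel.uniformizer_lt_one)
  have hρ : ∀ P ∈ kernel w V, w P.zCoord ≤ w ϖ := fun P hP => by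
    refine (hwv.le_iff_le).mpr ?_
    rw [hϖ]
    exact ValuativeRel.le_uniformizer_iff.mpr (hwv.lt_one_iff_lt_one.mp (val_zCoord_lt_one hP))
  have key : ∀ P ∈ kernel w V, ∀ r : ℕ, (p ^ r) • P ∈ level w V (w (p : F)) ∨
      w ((p ^ r) • P).zCoord ≤ w ϖ ^ (2 ^ r) := by
    intro P hP r
    induction r with
    | zero => exact Or.inr (by rw [pow_zero, one_nsmul, pow_zero, pow_one]; exact hρ P hP)
    | succ r ih =>
      have e : (p ^ (r + 1)) • P = p • (p ^ r) • P := by rw [pow_succ', mul_nsmul']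
      rcases ih with h | h
      · exact Or.inl (by rw [e]; exact (level w V (w (p : F))).nsmul_mem h p)
      · by_cases hs : w ((p ^ r) • P).zCoord ≤ w (p : F)
        · exact Or.inl (by
            rw [e]
            exact (level w V (w (p : F))).nsmul_mem ⟨(kernel w V).nsmul_mem hP _, hs⟩ p)
        · right
          have hlt : w (p : F) < w ((p ^ r) • P).zCoord := lt_of_not_ge hs
          have hK : (p ^ r) • P ∈ kernel w V := (kernel w V).nsmul_mem hP _
          have h1 := val_zCoord_nsmul_sub_le hK p
          have h2 : w ((p : F) * ((p ^ r) • P).zCoord) ≤ w ((p ^ r) • P).zCoord ^ 2 := by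
            rw [map_mul, pow_two]
            exact mul_le_mul' hlt.le le_rfl
          have e2 : (p • (p ^ r) • P).zCoord =
              ((p • (p ^ r) • P).zCoord - p * ((p ^ r) • P).zCoord) +
                p * ((p ^ r) • P).zCoord := by ring
          rw [e, e2]
          refine ((w.map_add _ _).trans (max_le h1 h2)).trans ?_
          calc w ((p ^ r) • P).zCoord ^ 2 ≤ (w ϖ ^ (2 ^ r)) ^ 2 := by gcongr
            _ = w ϖ ^ (2 ^ (r + 1)) := by rw [← pow_mul, pow_succ]
  obtain ⟨n, hn⟩ := exists_pow_lt_of_lt_one hp hρ1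
  refine ⟨n, fun P hP => ?_⟩
  rcases key P hP n with h | h
  · exact h
  · refine ⟨(kernel w V).nsmul_mem hP _, h.trans ?_⟩
    exact (pow_le_pow_right_of_le_one' hρ1.le (Nat.lt_two_pow_self).le).trans hn.le

/-- ★ **A nonzero additive functional `φ : E(F) →+ ℤ_p` over ANY `p`-adic field `F`** (no unramifiedness clause):
`φ(P) := Tr_{F/ℚ_p}(log_ω(M • P))` with `M = [E(F) : E₁(F)] · p^r`, `r` the uniform exponent of `exists_pow_forall_nsmul_mem_level`
(`M • P ∈ E⁽ᵖ⁾`, so `|log_ω(M • P)| ≤ |p|`); additive by [ADD]; nonzero by [N]. [cite: SilvermanAEC2009, Thm. IV.6.4 (b) with Prop. VII.2.2]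
[cite: Kato1993LNM1553, Ch. II §1.2.4 and Thm. 1.4.1 (4)] -/
theorem exists_addMonoidHom_point_padicInt_ne_zero' (hp : valuation F p < 1) [Algebra ℚ_[p] F] (V : WeierstrassCurve F)
    [V.IsElliptic] (w : Valuation F ℝ≥0) [w.Compatible] [hV : V.IsIntegral w.integer] :
    ∃ φ : V.toAffine.Point →+ ℤ_[p], φ ≠ 0 := by
  have hp0 : (p : F) ≠ 0 := Nat.cast_ne_zero.mpr (Fact.out : p.Prime).ne_zero
  have hwv : w.IsEquiv (valuation F) := ValuativeRel.isEquiv w (valuation F)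
  have hwp : w (p : F) < 1 := hwv.lt_one_iff_lt_one.mpr hp
  obtain ⟨r, hr⟩ := exists_pow_forall_nsmul_mem_level (p := p) V w hp0
  -- `M = [E(F) : E₁(F)] · p^r`, and `M • P ∈ E⁽ᵖ⁾`
  set M : ℕ := p ^ r * (kernel w V).index with hM
  have hM0 : M ≠ 0 := mul_ne_zero (pow_ne_zero r (Fact.out : p.Prime).ne_zero) (index_kernel_ne_zero V w)
  have hlev : ∀ P : V.toAffine.Point, M • P ∈ level w V (w (p : F)) := fun P => by
    rw [hM, mul_nsmul']
    exact hr _ (AddSubgroup.nsmul_index_mem (kernel w V) P)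
  have hval : ∀ P : V.toAffine.Point, valuation F (padicLogPointFiniteExt w V p (M • P)) ≤ 1 := fun P => by
    have h := val_padicLogPointFiniteExt_le_of_mem_level hp0 hwp (limitLog_spec_of_isNonarchimedeanLocalField V w hp0 hp)
      (hlev P)
    exact hwv.le_one_iff_le_one.mp (h.trans hwp.le)
  have hint : ∀ P : V.toAffine.Point, ‖Algebra.trace ℚ_[p] F (padicLogPointFiniteExt w V p (M • P))‖ ≤ 1 := fun P =>
    norm_trace_le_one_of_valuation_le_one hp (hval P)
  let φ : V.toAffine.Point →+ ℤ_[p] :=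
    { toFun := fun P => ⟨Algebra.trace ℚ_[p] F (padicLogPointFiniteExt w V p (M • P)), hint P⟩
      map_zero' := by
        apply Subtype.ext
        change Algebra.trace ℚ_[p] F (padicLogPointFiniteExt w V p (M • (0 : V.toAffine.Point))) = 0
        rw [nsmul_zero, padicLogPointFiniteExt_zero_of_isNonarchimedeanLocalField V w hp0 hp, map_zero]
      map_add' := fun P Q => by
        apply Subtype.ext
        change Algebra.trace ℚ_[p] F (padicLogPointFiniteExt w V p (M • (P + Q))) =
          Algebra.trace ℚ_[p] F (padicLogPointFiniteExt w V p (M • P)) +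
            Algebra.trace ℚ_[p] F (padicLogPointFiniteExt w V p (M • Q))
        rw [nsmul_add, padicLogPointFiniteExt_add_of_isNonarchimedeanLocalField V w hp0 hp, map_add] }
  refine ⟨φ, fun h0 => hM0 ?_⟩
  have hb : ∀ P : V.toAffine.Point, Algebra.trace ℚ_[p] F ((M : F) * padicLogPointFiniteExt w V p P) = 0 := fun P => by
    rw [← padicLogPointFiniteExt_nsmul_of_isNonarchimedeanLocalField V w hp0 hp P M]
    have h := DFunLike.congr_fun h0 P
    exact congrArg ((↑) : ℤ_[p] → ℚ_[p]) h
  have hMF : (M : F) = 0 := eq_zero_of_forall_trace_mul_padicLog_eq_zero hp V w hb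
  exact_mod_cast hMF

/-- ★ **`hφ` verbatim, over ANY `p`-adic field `F ⊇ K₀`**: `∃ φ : (W ×_{K₀} F)(F) →+ ℤ_p, φ ≠ 0` for every compatible `w` making the model
integral — the hypothesis `hφ` of `ReciprocityLawTowerAssembly` / `exists_const_tower_clauses_of_galois` / `exists_const_tower_clauses_of_formula_above`.
[cite: SilvermanAEC2009, Thm. IV.6.4 (b) with Prop. VII.2.2] [cite: Kato1993LNM1553, Ch. II §1.2.4 and Thm. 1.4.1 (4)] -/
theorem exists_addMonoidHom_baseChange_point_padicInt_ne_zero' {K₀ : Type} [Field K₀] (W : WeierstrassCurve K₀) [W.IsElliptic]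
    [Algebra K₀ F] (hp : valuation F p < 1) (w : Valuation F ℝ≥0) [w.Compatible] [(W.baseChange F).IsIntegral w.integer] :
    ∃ φ : (W.baseChange F).toAffine.Point →+ ℤ_[p], φ ≠ 0 := by
  letI : Algebra ℚ_[p] F := LocalField.padicAlgebra F p hp
  exact exists_addMonoidHom_point_padicInt_ne_zero' hp (W.baseChange F) w

end Literature.NumberTheory.PAdicHodge

end
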